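import Summits.Ventures.LatticeQCDFlow.TrivializingMaps.AcceptanceFootprint
import HarnessLib

/-!
# The acceptance–footprint law: `4` is the sharp constant, and there is no law at acceptance `≤ ½`

HONEST FRAMING: exact (Metropolis-corrected) sampling algorithms for lattice gauge theory; figures of merit are
autocorrelation/cost numbers at stated couplings and volumes; no continuum-physics claim.

Venture `LatticeQCDFlow` (cell pub-lqcd), topic `TrivializingMaps`; FANOUT row 28 (theory-1), THEOREM Q♯ /
(O1) of THEORY-1 §33.  NEW WORK of the cell (two explicit four-point examples); nothing is cited as a fact.
Independent of the companion `AcceptanceFootprintSharp` (which proves the law WITH constant `4`): this file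
only uses the tree's `AcceptanceFootprint` vocabulary (`integral_withDensity_ofReal_eq`).

## What is proved (0 `sorry`)

Everything on two links with two states each (`Bool × Bool`, counting reference measure), in the EXACT
hypotheses of the tree's `abs_cov_le_of_meanAccept` (densities `p, q ≥ 0` of unit mass, equilibrium acceptance
`ā = ∫∫ min (p x q y, p y q x)`, bounded measurable witnesses exactly uncorrelated under the model):
* **`Sharp.corner_family`** — MODEL = the frozen configuration `(+,+)` (a range-`0` proposal), TARGET
  `(1 - λ) δ₊₊ + λ δ₋₋`, `A = σ₁`, `B = σ₂`: acceptance `ā = 1 - λ` EXACTLY and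
  `Cov_π(A, B) = 4 λ (1 - λ) = 4 (1 - ā)(1 - λ)`; hence **`Sharp.four_le_of_linear_law`**: every constant `c`
  for which `|Cov_π(A, B)| ≤ c (1 - acc) a b` holds under these hypotheses satisfies `4 ≤ c` (and `c = 4` holds:
  `Sharp.linear_law_four` in the companion) — THE CONSTANT `4` IS SHARP, the tree's `6` was not.
* **`Sharp.floor_family`** — MODEL = the uniform (Haar) law (the identity flow), TARGET `½ (δ₊₊ + δ₋₋)`:
  acceptance `ā = ½` EXACTLY while `Cov_π(A, B) = 1 = a b`; hence **`Sharp.one_le_of_law`**: every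
  acceptance-only law `|Cov_π(A, B)| ≤ g(acc) a b` valid under these hypotheses has `g(acc) ≥ 1` for every
  `acc ≤ ½` — at equilibrium acceptance one half the acceptance figure carries NO footprint information.

READING.  The footprint law `|Cov| ≤ 4 (1 - acc) a b` bites for `acc > ¾`, is void for `acc ≤ ½` (any law is),
and cannot be improved in the linear form.  NOT CLAIMED: the exact non-linear curve `g♯(acc) = sup |Cov|/(a b)` on
`(½, 1)` — only `g♯ ≤ 4 (1 - acc)`, `g♯(acc) = 1` for `acc ≤ ½` and `g♯(1 - λ) ≥ 4 λ (1 - λ)` are settled.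
-/

namespace Summit.Ventures.LatticeQCDFlow.TrivializingMaps

open MeasureTheory Set
open scoped ENNReal NNReal

/-! ## Sharpness: two links with two states each -/

namespace Sharp

/-- Integral against the counting measure on `Bool × Bool` = the four-term sum. -/
theorem integral_count_boolProd (f : Bool × Bool → ℝ) :
    ∫ z, f z ∂(Measure.count : Measure (Bool × Bool))
      = f (true, true) + f (true, false) + (f (false, true) + f (false, false)) := by
  rw [integral_count, Fintype.sum_prod_type, Fintype.sum_bool, Fintype.sum_bool, Fintype.sum_bool]

/-- Integral against a real density on `Bool × Bool` (counting reference measure). -/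
theorem integral_withDensity_count_boolProd {p : Bool × Bool → ℝ} (hp0 : ∀ z, 0 ≤ p z)
    (f : Bool × Bool → ℝ) :
    ∫ z, f z ∂((Measure.count : Measure (Bool × Bool)).withDensity fun z => ENNReal.ofReal (p z))
      = p (true, true) * f (true, true) + p (true, false) * f (true, false)
        + (p (false, true) * f (false, true) + p (false, false) * f (false, false)) := by
  rw [integral_withDensity_ofReal_eq hp0 (measurable_of_countable p), integral_count_boolProd]

/-- **THE CORNER FAMILY** (`0 ≤ λ ≤ 1`).  Reference = counting measure on `Bool × Bool` (two links, two
states); MODEL density `q = 1_{(+,+)}` (the frozen configuration: a range-`0` proposal); TARGET density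
`p = (1 - λ) 1_{(+,+)} + λ 1_{(-,-)}`; `A = σ₁`, `B = σ₂` (`±1` spins of the two links).  All hypotheses of
`abs_cov_le_of_meanAccept` hold with `a = b = 1`; the equilibrium acceptance is EXACTLY `1 - λ` and
`Cov_π(A, B) = 4 λ (1 - λ) = 4 (1 - ā) (1 - λ)`. -/
theorem corner_family {lam : ℝ} (h0 : 0 ≤ lam) (h1 : lam ≤ 1) {p q A B : Bool × Bool → ℝ}
    (hp : ∀ z, p z = if z.1 = z.2 then (if z.1 = true then 1 - lam else lam) else 0)
    (hq : ∀ z, q z = if z = (true, true) then 1 else 0)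
    (hA : ∀ z, A z = if z.1 = true then 1 else -1) (hB : ∀ z, B z = if z.2 = true then 1 else -1) :
    (∀ z, 0 ≤ p z) ∧ Measurable p ∧ Integrable p (Measure.count : Measure (Bool × Bool))
      ∧ ∫ z, p z ∂(Measure.count : Measure (Bool × Bool)) = 1
      ∧ (∀ z, 0 ≤ q z) ∧ Measurable q ∧ Integrable q (Measure.count : Measure (Bool × Bool))
      ∧ ∫ z, q z ∂(Measure.count : Measure (Bool × Bool)) = 1
      ∧ Measurable A ∧ Measurable B ∧ (∀ z, |A z| ≤ 1) ∧ (∀ z, |B z| ≤ 1)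
      ∧ ∫ z, A z * B z ∂((Measure.count : Measure (Bool × Bool)).withDensity fun z => ENNReal.ofReal (q z))
          = (∫ z, A z ∂((Measure.count : Measure (Bool × Bool)).withDensity fun z => ENNReal.ofReal (q z)))
            * ∫ z, B z ∂((Measure.count : Measure (Bool × Bool)).withDensity fun z => ENNReal.ofReal (q z))
      ∧ ∫ x, ∫ y, min (p x * q y) (p y * q x) ∂(Measure.count : Measure (Bool × Bool))
          ∂(Measure.count : Measure (Bool × Bool)) = 1 - lam
      ∧ ∫ z, A z * B z ∂((Measure.count : Measure (Bool × Bool)).withDensity fun z => ENNReal.ofReal (p z))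
          - (∫ z, A z ∂((Measure.count : Measure (Bool × Bool)).withDensity fun z => ENNReal.ofReal (p z)))
            * ∫ z, B z ∂((Measure.count : Measure (Bool × Bool)).withDensity fun z => ENNReal.ofReal (p z))
          = 4 * lam * (1 - lam) := by
  have hp0 : ∀ z, 0 ≤ p z := fun z => by
    rw [hp z]; split_ifs <;> linarith
  have hq0 : ∀ z, 0 ≤ q z := fun z => by
    rw [hq z]; split_ifs <;> norm_num
  have hA1 : ∀ z, |A z| ≤ 1 := fun z => by
    rw [hA z]; split_ifs <;> norm_num
  have hB1 : ∀ z, |B z| ≤ 1 := fun z => by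
    rw [hB z]; split_ifs <;> norm_num
  refine ⟨hp0, measurable_of_countable p, Integrable.of_finite, ?_, hq0, measurable_of_countable q,
    Integrable.of_finite, ?_, measurable_of_countable A, measurable_of_countable B, hA1, hB1, ?_, ?_, ?_⟩
  · rw [integral_count_boolProd]; simp only [hp]; norm_num
  · rw [integral_count_boolProd]; simp only [hq]; norm_num
  · rw [integral_withDensity_count_boolProd hq0, integral_withDensity_count_boolProd hq0,
      integral_withDensity_count_boolProd hq0]
    simp only [hq, hA, hB]; norm_num
  · simp only [integral_count_boolProd, hp, hq]
    norm_num [min_eq_left h0, min_eq_right h0]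
  · rw [integral_withDensity_count_boolProd hp0, integral_withDensity_count_boolProd hp0,
      integral_withDensity_count_boolProd hp0]
    simp only [hp, hA, hB]; norm_num; ring

/-- **THE CONSTANT `4` IS SHARP.**  If `|Cov_π(A, B)| ≤ c (1 - acc) a b` holds for all targets, models and
witnesses satisfying the hypotheses of `abs_cov_le_of_meanAccept` — already on two links with two states
each — then `4 ≤ c`.  (With the companion's `Sharp.linear_law_four`: the best constant is exactly `4`; the tree's `6` was not sharp.) -/
theorem four_le_of_linear_law {c : ℝ}
    (hlaw : ∀ (p q A B : Bool × Bool → ℝ) (a b acc : ℝ), (∀ z, 0 ≤ p z) → Measurable p →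
      Integrable p (Measure.count : Measure (Bool × Bool)) →
      ∫ z, p z ∂(Measure.count : Measure (Bool × Bool)) = 1 → (∀ z, 0 ≤ q z) → Measurable q →
      Integrable q (Measure.count : Measure (Bool × Bool)) →
      ∫ z, q z ∂(Measure.count : Measure (Bool × Bool)) = 1 →
      acc ≤ ∫ x, ∫ y, min (p x * q y) (p y * q x) ∂(Measure.count : Measure (Bool × Bool))
        ∂(Measure.count : Measure (Bool × Bool)) →
      Measurable A → Measurable B → (∀ z, |A z| ≤ a) → (∀ z, |B z| ≤ b) →
      ∫ z, A z * B z ∂((Measure.count : Measure (Bool × Bool)).withDensity fun z => ENNReal.ofReal (q z))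
        = (∫ z, A z ∂((Measure.count : Measure (Bool × Bool)).withDensity fun z => ENNReal.ofReal (q z)))
          * ∫ z, B z ∂((Measure.count : Measure (Bool × Bool)).withDensity fun z => ENNReal.ofReal (q z)) →
      |∫ z, A z * B z ∂((Measure.count : Measure (Bool × Bool)).withDensity fun z => ENNReal.ofReal (p z))
        - (∫ z, A z ∂((Measure.count : Measure (Bool × Bool)).withDensity fun z => ENNReal.ofReal (p z)))
          * ∫ z, B z ∂((Measure.count : Measure (Bool × Bool)).withDensity fun z => ENNReal.ofReal (p z))|
        ≤ c * (1 - acc) * (a * b)) :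
    4 ≤ c := by
  by_contra hc
  rw [not_le] at hc
  set lam : ℝ := min (1 / 2) ((4 - c) / 8) with hlam
  have hlam0 : 0 < lam := lt_min (by norm_num) (by linarith)
  have hlam1 : lam ≤ 1 := (min_le_left _ _).trans (by norm_num)
  have hlamc : lam ≤ (4 - c) / 8 := min_le_right _ _
  obtain ⟨hp0, hpm, hpi, hp1, hq0, hqm, hqi, hq1, hAm, hBm, hA1, hB1, hfac, hacc, hcov⟩ :=
    corner_family hlam0.le hlam1
      (p := fun z => if z.1 = z.2 then (if z.1 = true then 1 - lam else lam) else 0)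
      (q := fun z => if z = (true, true) then 1 else 0)
      (A := fun z => if z.1 = true then 1 else -1) (B := fun z => if z.2 = true then 1 else -1)
      (fun _ => rfl) (fun _ => rfl) (fun _ => rfl) (fun _ => rfl)
  have h := hlaw _ _ _ _ 1 1 (1 - lam) hp0 hpm hpi hp1 hq0 hqm hqi hq1 hacc.symm.le hAm hBm hA1 hB1 hfac
  rw [hcov, abs_of_nonneg (by nlinarith)] at h
  nlinarith [mul_le_mul_of_nonneg_right hlamc hlam0.le, mul_pos hlam0 hlam0]

/-- **THE FLOOR FAMILY.**  Reference = counting measure on `Bool × Bool`; MODEL density `q = ¼` (the uniform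
/ Haar law: the identity flow, range `0`); TARGET density `p = ½ 1_{σ₁ = σ₂}` (the two links perfectly
aligned); `A = σ₁`, `B = σ₂`.  All hypotheses of `abs_cov_le_of_meanAccept` hold with `a = b = 1`; the
equilibrium acceptance is EXACTLY `½` while `Cov_π(A, B) = 1 = a b`. -/
theorem floor_family {p q A B : Bool × Bool → ℝ}
    (hp : ∀ z, p z = if z.1 = z.2 then 1 / 2 else 0) (hq : ∀ z, q z = 1 / 4)
    (hA : ∀ z, A z = if z.1 = true then 1 else -1) (hB : ∀ z, B z = if z.2 = true then 1 else -1) :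
    (∀ z, 0 ≤ p z) ∧ Measurable p ∧ Integrable p (Measure.count : Measure (Bool × Bool))
      ∧ ∫ z, p z ∂(Measure.count : Measure (Bool × Bool)) = 1
      ∧ (∀ z, 0 ≤ q z) ∧ Measurable q ∧ Integrable q (Measure.count : Measure (Bool × Bool))
      ∧ ∫ z, q z ∂(Measure.count : Measure (Bool × Bool)) = 1
      ∧ Measurable A ∧ Measurable B ∧ (∀ z, |A z| ≤ 1) ∧ (∀ z, |B z| ≤ 1)
      ∧ ∫ z, A z * B z ∂((Measure.count : Measure (Bool × Bool)).withDensity fun z => ENNReal.ofReal (q z))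
          = (∫ z, A z ∂((Measure.count : Measure (Bool × Bool)).withDensity fun z => ENNReal.ofReal (q z)))
            * ∫ z, B z ∂((Measure.count : Measure (Bool × Bool)).withDensity fun z => ENNReal.ofReal (q z))
      ∧ ∫ x, ∫ y, min (p x * q y) (p y * q x) ∂(Measure.count : Measure (Bool × Bool))
          ∂(Measure.count : Measure (Bool × Bool)) = 1 / 2
      ∧ ∫ z, A z * B z ∂((Measure.count : Measure (Bool × Bool)).withDensity fun z => ENNReal.ofReal (p z))
          - (∫ z, A z ∂((Measure.count : Measure (Bool × Bool)).withDensity fun z => ENNReal.ofReal (p z)))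
            * ∫ z, B z ∂((Measure.count : Measure (Bool × Bool)).withDensity fun z => ENNReal.ofReal (p z))
          = 1 := by
  have hp0 : ∀ z, 0 ≤ p z := fun z => by
    rw [hp z]; split_ifs <;> norm_num
  have hq0 : ∀ z, 0 ≤ q z := fun z => by rw [hq z]; norm_num
  have hA1 : ∀ z, |A z| ≤ 1 := fun z => by
    rw [hA z]; split_ifs <;> norm_num
  have hB1 : ∀ z, |B z| ≤ 1 := fun z => by
    rw [hB z]; split_ifs <;> norm_num
  refine ⟨hp0, measurable_of_countable p, Integrable.of_finite, ?_, hq0, measurable_of_countable q,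
    Integrable.of_finite, ?_, measurable_of_countable A, measurable_of_countable B, hA1, hB1, ?_, ?_, ?_⟩
  · rw [integral_count_boolProd]; simp only [hp]; norm_num
  · rw [integral_count_boolProd]; simp only [hq]; norm_num
  · rw [integral_withDensity_count_boolProd hq0, integral_withDensity_count_boolProd hq0,
      integral_withDensity_count_boolProd hq0]
    simp only [hq, hA, hB]; norm_num
  · simp only [integral_count_boolProd, hp, hq]
    norm_num
  · rw [integral_withDensity_count_boolProd hp0, integral_withDensity_count_boolProd hp0,
      integral_withDensity_count_boolProd hp0]
    simp only [hp, hA, hB]; norm_num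

/-- **NO FOOTPRINT LAW AT ACCEPTANCE ONE HALF.**  If `|Cov_π(A, B)| ≤ g(acc) a b` holds for all targets,
models and witnesses satisfying the hypotheses of `abs_cov_le_of_meanAccept` (already on two links with two
states each), then `g(acc) ≥ 1` for every `acc ≤ ½` — i.e. the law says nothing beyond the trivial
`|Cov| ≤ a b` there. -/
theorem one_le_of_law (g : ℝ → ℝ)
    (hlaw : ∀ (p q A B : Bool × Bool → ℝ) (a b acc : ℝ), (∀ z, 0 ≤ p z) → Measurable p →
      Integrable p (Measure.count : Measure (Bool × Bool)) →
      ∫ z, p z ∂(Measure.count : Measure (Bool × Bool)) = 1 → (∀ z, 0 ≤ q z) → Measurable q →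
      Integrable q (Measure.count : Measure (Bool × Bool)) →
      ∫ z, q z ∂(Measure.count : Measure (Bool × Bool)) = 1 →
      acc ≤ ∫ x, ∫ y, min (p x * q y) (p y * q x) ∂(Measure.count : Measure (Bool × Bool))
        ∂(Measure.count : Measure (Bool × Bool)) →
      Measurable A → Measurable B → (∀ z, |A z| ≤ a) → (∀ z, |B z| ≤ b) →
      ∫ z, A z * B z ∂((Measure.count : Measure (Bool × Bool)).withDensity fun z => ENNReal.ofReal (q z))
        = (∫ z, A z ∂((Measure.count : Measure (Bool × Bool)).withDensity fun z => ENNReal.ofReal (q z)))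
          * ∫ z, B z ∂((Measure.count : Measure (Bool × Bool)).withDensity fun z => ENNReal.ofReal (q z)) →
      |∫ z, A z * B z ∂((Measure.count : Measure (Bool × Bool)).withDensity fun z => ENNReal.ofReal (p z))
        - (∫ z, A z ∂((Measure.count : Measure (Bool × Bool)).withDensity fun z => ENNReal.ofReal (p z)))
          * ∫ z, B z ∂((Measure.count : Measure (Bool × Bool)).withDensity fun z => ENNReal.ofReal (p z))|
        ≤ g acc * (a * b))
    {acc : ℝ} (hacc : acc ≤ 1 / 2) : 1 ≤ g acc := by
  obtain ⟨hp0, hpm, hpi, hp1, hq0, hqm, hqi, hq1, hAm, hBm, hA1, hB1, hfac, hmean, hcov⟩ :=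
    floor_family (p := fun z => if z.1 = z.2 then 1 / 2 else 0) (q := fun _ => 1 / 4)
      (A := fun z => if z.1 = true then 1 else -1) (B := fun z => if z.2 = true then 1 else -1)
      (fun _ => rfl) (fun _ => rfl) (fun _ => rfl) (fun _ => rfl)
  have h := hlaw _ _ _ _ 1 1 acc hp0 hpm hpi hp1 hq0 hqm hqi hq1 (hacc.trans hmean.symm.le) hAm hBm hA1
    hB1 hfac
  rw [hcov] at h
  norm_num at h
  exact h

end Sharp

end Summit.Ventures.LatticeQCDFlow.TrivializingMaps
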